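import Mathlib
import HarnessLib
import Summits.QuantumAdvantage.QuantumAdvantage.Theses.CodeCarries

/-!
# Birth skeleton (BC3) for the crux `CodeCarries.OpiLiftPromise`
(item stmt-QuantumAdvantage-0993; route route-QuantumAdvantage-CodeCarries, crux rank 2) —
skeleton registrar planner-skel-stmt-QuantumAdvantage-0993-0, 2026-08-17.

The crux (`Summit.QuantumAdvantage.QuantumAdvantage.Theses.CodeCarries.OpiLiftPromise`):
`R_OPI(7/10) ∈ FBPP^{PromiseBQP}` in instance form — some promise problem `Q ∈ PromiseBQP` and some
polynomial-time oracle algorithm `M` (transcript model `OracleAlg`, coins appended to the input) such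
that for EVERY oracle consistent with `Q` and every large valid OPI instance `(p, F)` (p prime, `p - 1`
balanced allowed sets of size `⌊p/2⌋`, `n = ⌈p/10⌉` coefficients, threshold `7/10`), `M^O` outputs a
Good coefficient list with probability `≥ 2/3`.

## The seam: GUIDED COEFFICIENT DESCENT = (quantum prefix guide) ∘ (classical search-to-decision)

The route's declared attack (route header, NOT DECOMPOSED YET; card D3) is a classical descent fixing the
TOP coefficients one at a time and asking a gapped PromiseBQP question about the residual (RS-shortened)
instance. This skeleton cuts the crux along exactly that seam, through one named interface:

* `IsPrefixGuide Q P₀` — a purely combinatorial property of a promise problem `Q`: there is a liveness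
  predicate on (instance, fixed top block `τ`) with ROOT (the empty block is live), EXTENSION (a live
  block of length `< n` has a next coefficient `a < p` whose query string `qenc p F (a :: τ)` is a
  YES-instance of `Q`), SOUNDNESS (a child that is not a NO-instance is live) and LEAF (a live block of
  length `n` is Good). Queries are the fixed strings `qenc p F τ := boolPair (encI p F) (encode τ)`.
* `complSucc Fam p F τ` — for a Clifford+T family `Fam` run on `qenc p F τ` and measured on all wires,
  the probability that the output starts with the encoding of a low block `cs'` such that `cs' ++ τ`
  is Good ("re-solve the residual instance"); `GapQ Fam` — the gapped promise problem
  `yes = {2/3 ≤ complSucc}`, `no = {complSucc < 1/3}` on query strings; `Steers Fam P₀` — ROOT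
  (`1/3 ≤ complSucc Fam p F []`, i.e. `Fam` solves OPI outright: the DQI half) and EXTENSION
  (`1/3 ≤ complSucc Fam p F τ → ∃ a < p, 2/3 ≤ complSucc Fam p F (a :: τ)`, `|τ| < n`).

Three registered stubs:

* `stub_steer` (OPEN, the residue of the crux, hardest): some uniform oracle-free Clifford+T family
  STEERS above some `P₀`. Why it might fail = why the crux might: for plain DQI + Berlekamp–Massey,
  re-preparation on the shortened RS code `[p−1, p−n−1+t, n+1−t]` keeps the semicircle value
  `1/2 + √(x(1−x))`, `x = ⌊(n−t)/2⌋/(p−1)`, above `0.70` only for `t ≲ n/6` of the `n` levels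
  (refuter note 2026-08-15 on the item; Gil-Fuster et al. arXiv:2607.28120 App. D2), and filtering the
  ROOT law instead dilutes the mass by the min-entropy of DQI's Good outputs; the bet is a list-decoding
  (Guruswami–Sudan / Koetter–Vardy radius `m − √(mk)`) re-solver, or any cleverer `Fam` — the stub
  quantifies over all uniform families. It is NOT the crux reworded: it is a SELF-CONSISTENCY property of
  one quantum solver under coefficient fixing (strictly stronger in kind: the crux's `M` may use its
  oracle arbitrarily), and it gives the crux back only through the two other stubs.
* `stub_gapMem` (TRUE IN PRINT, size L–XL in Lean): for every uniform oracle-free Clifford+T family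
  `Fam`, `GapQ Fam ∈ PromiseBQP` — copy the input, run `Fam`, compute the P-decidable predicate
  "the all-wires outcome starts with `encode cs'` and `cs' ++ τ` is Good for the instance encoded in the
  input" reversibly into a fresh wire and swap it to wire 0 (deferred measurement: acceptance probability
  = `complSucc` exactly); uniformity = `Fam`'s uniformity + a uniform reversible compilation of a
  polynomial-time predicate (Bennett 1973; Nielsen–Chuang §4.4, §3.2.5; Watrous 2009 §III.1–2; the
  tree's fact `P_subset_BQP` is the same compilation).
* `stub_guidedDescent` (TRUE, classical plumbing in the transcript model, size L): every prefix guide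
  `Q` (ANY promise problem, no quantum content) yields a polynomial-time `OracleAlg` which, for EVERY
  oracle consistent with `Q`, outputs a Good list on every large valid instance with probability `≥ 2/3`
  (in fact `1`: the coins are ignored) — at each of the `n` levels scan `a = 0, …, p−1`, query
  `qenc p F (a :: τ)`, keep the first `a` answered `[true]` (it exists by EXTENSION + consistency on
  `Q.yes`; it is live by SOUNDNESS, since a `[true]` answer is not a NO-instance); after `n` levels LEAF
  gives Good. Budget: `≤ n·p + 1` rounds, queries of length `2|x| + 2 + |encode τ|`, step function =
  replay of the transcript (poly-time; `OracleClosure.lean`-style `FinTM2` assembly).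

`OpiLiftPromise_of : Sig.stub_steer → Sig.stub_gapMem → Sig.stub_guidedDescent → OpiLiftPromise`
concludes the route decl BY NAME and is proved sorry-free (with the in-file lemmas
`good_of_complSucc` — LEAF is automatic: at full length the only completion is `[]`, and an empty
success event has probability `0` — and `isPrefixGuide_of_steers`); `OpiLiftPromise_proof :
OpiLiftPromise` is the skeleton in its final shape (depends on `sorryAx` through the stubs only).

## Disproof / negatives used

`Cruxes/OpiLiftPromise/` had no workfiles before this one (no `Disproof.lean`, no dead lines;
`ledger crux ls stmt-QuantumAdvantage-0993`, 2026-08-17). The item's refuter notes (route reviews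
2026-08-15) are honoured at `stub_steer` (the depth-`n/6` obstruction for plain DQI is stated in its
docstring as the reason the stub is open). Neither stub is a refuted statement of
`ledger negatives --problem QuantumAdvantage` (none concerns OPI / DQI descents).

## BC3 audit (this seat; raw outputs in the seat's NOTES.md `birth-certificate:`)

`lean check --json` rc 0 with `sorry` exactly in `stub_steer`, `stub_gapMem`, `stub_guidedDescent`
(sorry count 3 = stub count, zero elsewhere); probes `stub → OpiLiftPromise` and
`stub → QuantumAdvantage` by `first | exact? | simpa [stub] | (unfold stub; simpa) | aesop` FAIL for all
three stubs (6/6), files `bc/OpiLiftPromise_probe_<stub>.lean` of the seat folder.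
-/

set_option linter.dupNamespace false

noncomputable section

namespace Summit.QuantumAdvantage.QuantumAdvantage.Cruxes.OpiLiftPromise.Birth

open _root_.Computability
open Literature.Computability.Complexity Literature.Computability.Cryptography
open Summit.QuantumAdvantage.QuantumAdvantage.Theses.CodeCarries

/-! ### Vocabulary: the crux's inline OPI conventions, named -/

/-- `Valid P₀ p F`: the crux's validity convention — `p` prime, `P₀ ≤ p`, `F` lists the `p − 1` allowed
sets `F_y ⊆ [0,p)` (`y = 1..p−1`), each duplicate-free of size `⌊p/2⌋`. -/
def Valid (P₀ p : ℕ) (F : List (List ℕ)) : Prop :=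
  p.Prime ∧ P₀ ≤ p ∧ F.length = p - 1 ∧ ∀ S ∈ F, S.Nodup ∧ S.length = p / 2 ∧ ∀ v ∈ S, v < p

/-- `Good p F cs`: the crux's goodness convention — `cs` lists the `n = (p+9)/10` coefficients of
`Q = Σ cs[i] X^i`, all `< p`, and `Q(j+1) mod p ∈ F[j]` for at least `7/10` of the `j < p − 1`. -/
def Good (p : ℕ) (F : List (List ℕ)) (cs : List ℕ) : Prop :=
  cs.length = (p + 9) / 10 ∧ (∀ a ∈ cs, a < p) ∧
    7 * (p - 1) ≤ 10 * ((List.range (p - 1)).filter (fun j =>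
      decide ((((List.range cs.length).map (fun i => cs.getD i 0 * (j + 1) ^ i)).sum % p) ∈ F.getD j []))).length

/-- `encI p F`: the crux's instance encoding `boolPair (encodeNat p) (listBool-encode F)`. -/
def encI (p : ℕ) (F : List (List ℕ)) : List Bool :=
  boolPair (encodeNat p) (encodingListNatBool.listBool.encode F)

/-- `qenc p F τ`: the QUERY STRING for the instance `(p, F)` with fixed TOP coefficient block `τ`
(the last `|τ|` entries of a candidate coefficient list): `boolPair (encI p F) (encode τ)`. -/
def qenc (p : ℕ) (F : List (List ℕ)) (τ : List ℕ) : List Bool :=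
  boolPair (encI p F) (encodingListNatBool.encode τ)

/-! ### The interface: prefix guides -/

/-- `IsPrefixGuide Q P₀`: the promise problem `Q` GUIDES the top-down coefficient descent for OPI above
`P₀` — there is a liveness predicate `Live p F τ` on fixed top blocks with
ROOT (`[]` is live on every valid instance), EXTENSION (a live block of length `< n` has a next
coefficient `a < p` with `qenc p F (a :: τ) ∈ Q.yes`), SOUNDNESS (for a live block of length `< n` and
`a < p`, if `qenc p F (a :: τ) ∉ Q.no` then `a :: τ` is live) and LEAF (a live block of length `n` is
Good). Purely combinatorial (no quantum content). -/
def IsPrefixGuide (Q : PromiseProblem) (P₀ : ℕ) : Prop :=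
  ∃ Live : ℕ → List (List ℕ) → List ℕ → Prop,
    (∀ (p : ℕ) (F : List (List ℕ)), Valid P₀ p F → Live p F []) ∧
    (∀ (p : ℕ) (F : List (List ℕ)) (τ : List ℕ), Valid P₀ p F → Live p F τ →
        τ.length < (p + 9) / 10 → ∃ a : ℕ, a < p ∧ qenc p F (a :: τ) ∈ Q.yes) ∧
    (∀ (p : ℕ) (F : List (List ℕ)) (τ : List ℕ) (a : ℕ), Valid P₀ p F → Live p F τ →
        τ.length < (p + 9) / 10 → a < p → qenc p F (a :: τ) ∉ Q.no → Live p F (a :: τ)) ∧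
    (∀ (p : ℕ) (F : List (List ℕ)) (τ : List ℕ), Valid P₀ p F → Live p F τ →
        τ.length = (p + 9) / 10 → Good p F τ)

/-! ### The quantum side: completion success of a family, its gap problem, steering -/

/-- `complSucc Fam p F τ`: the probability that the Clifford+T family `Fam`, run on the query string
`qenc p F τ` (on `|x⟩|0…0⟩`, all wires measured), outputs a string beginning with the encoding of a
LOW block `cs'` such that `cs' ++ τ` is Good for `(p, F)` — "re-solve the residual instance". -/
def complSucc (Fam : QCircuitFamily cliffordT) (p : ℕ) (F : List (List ℕ)) (τ : List ℕ) : ℝ :=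
  Fam.kernelProb 0 (qenc p F τ)
    {y : List Bool | ∃ cs' : List ℕ, encodingListNatBool.encode cs' <+: y ∧ Good p F (cs' ++ τ)}

/-- `GapQ Fam`: the GAPPED COMPLETION-SUCCESS promise problem of `Fam` on query strings —
yes: `2/3 ≤ complSucc`, no: `complSucc < 1/3` (strings that are not query strings are off-promise). -/
def GapQ (Fam : QCircuitFamily cliffordT) : PromiseProblem where
  yes := {z : List Bool | ∃ (p : ℕ) (F : List (List ℕ)) (τ : List ℕ), z = qenc p F τ ∧
    (2 : ℝ) / 3 ≤ complSucc Fam p F τ}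
  no := {z : List Bool | ∃ (p : ℕ) (F : List (List ℕ)) (τ : List ℕ), z = qenc p F τ ∧
    complSucc Fam p F τ < (1 : ℝ) / 3}

/-- `Steers Fam P₀`: on every valid instance above `P₀`, ROOT — `Fam` finds a Good list outright with
probability `≥ 1/3` (`τ = []`; the DQI half) — and EXTENSION — whenever `Fam` re-solves a block `τ` of
length `< n` with probability `≥ 1/3`, some next top coefficient `a < p` is re-solved with probability
`≥ 2/3`. (Constants are immaterial up to in-family repetition, Good being P-checkable.) -/
def Steers (Fam : QCircuitFamily cliffordT) (P₀ : ℕ) : Prop :=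
  ∀ (p : ℕ) (F : List (List ℕ)), Valid P₀ p F →
    (1 : ℝ) / 3 ≤ complSucc Fam p F [] ∧
    ∀ τ : List ℕ, τ.length < (p + 9) / 10 → (1 : ℝ) / 3 ≤ complSucc Fam p F τ →
      ∃ a : ℕ, a < p ∧ (2 : ℝ) / 3 ≤ complSucc Fam p F (a :: τ)

/-! ### Stub signatures (`Sig.stub_*`, so that the hypothesis heads of `OpiLiftPromise_of` carry the
registered stub names) -/

/-- STUB 1 — A STEERABLE QUANTUM RE-SOLVER EXISTS (the residue of the crux; OPEN, hardest). Some
poly-time uniform, oracle-free Clifford+T family `Fam` and threshold `P₀` with `Steers Fam P₀`.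
Why it might fail: plain DQI+BM re-preparation on the shortened RS code survives only `≲ n/6` of the `n`
levels at threshold `0.70` (semicircle law on `[p−1, p−n−1+t, n+1−t]`); root-law filtering dilutes by
the min-entropy of DQI's Good outputs; a steerable family needs a larger decoding radius (list decoding,
`m − √(mk)`) or a new idea. Sources: arXiv:2408.08292 Thm 4.1 + §5; arXiv:2607.28120 App. D2;
Guruswami–Sudan 1999; Koetter–Vardy 2003; item notes of stmt-QuantumAdvantage-0993 (2026-08-15). -/
def Sig.stub_steer : Prop :=
  ∃ Fam : QCircuitFamily cliffordT, Fam.IsOracleFree ∧ Fam.IsUniform ∧ ∃ P₀ : ℕ, Steers Fam P₀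

/-- STUB 2 — THE GAP PROBLEM OF A UNIFORM FAMILY IS IN PromiseBQP (true in print; size L–XL in Lean).
For every uniform oracle-free Clifford+T family `Fam`, `GapQ Fam ∈ PromiseBQP`: copy the input, run
`Fam`, evaluate the polynomial-time predicate "outcome starts with `encode cs'` and `cs' ++ τ` is Good
for the instance encoded in the input" reversibly onto a fresh wire, swap it to wire `0` (acceptance
probability = `complSucc` exactly, by deferred measurement). Sources: Watrous 2009 §III.1–III.2;
Nielsen–Chuang §4.4 (deferred measurement), §3.2.5/§4.5.5 (reversible compilation, = the tree's fact
`P_subset_BQP`); Bennett 1973. -/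
def Sig.stub_gapMem : Prop :=
  ∀ Fam : QCircuitFamily cliffordT, Fam.IsOracleFree → Fam.IsUniform → GapQ Fam ∈ PromiseBQP

/-- STUB 3 — GUIDED DESCENT (classical search-to-decision plumbing in the transcript model; true,
size L in Lean). Every prefix guide `Q` above `P₀` yields a polynomial-time oracle algorithm `M` with
round/query budget `q` and coin length `k` such that for EVERY oracle answering `[true]` on `Q.yes` and
`[false]` on `Q.no`, on every valid instance above some `P₁`, with probability `≥ 2/3` over the coins
`M` outputs a Good list within `q |x|` rounds asking only queries of length `≤ q |x|` (the crux's
success clause verbatim, for this `Q`). Proof in print: top-down scan-and-fix (see the module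
docstring); coins ignored. Sources: Goldreich 2006 §1 (promise problems as oracles: answers off the
promise are arbitrary), Bellare–Goldwasser 1994 (search vs decision), Arora–Barak 2009 §2.5/§3.4;
tree: `Literature/Computability/Complexity/OracleClosure.lean` (FinTM2 assembly of step functions). -/
def Sig.stub_guidedDescent : Prop :=
  ∀ (Q : PromiseProblem) (P₀ : ℕ), IsPrefixGuide Q P₀ →
    ∃ M : OracleAlg (List ℕ), M.IsPolyTime encodingListNatBool ∧
      ∃ (q k : Polynomial ℕ) (P₁ : ℕ), ∀ O : Oracle,
        (∀ z ∈ Q.yes, O z = encodeBool true) → (∀ z ∈ Q.no, O z = encodeBool false) →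
        ∀ (p : ℕ) (F : List (List ℕ)), Valid P₁ p F →
          (2 : ℝ) / 3 ≤ uniformProb (k.eval (encI p F).length)
            {r : List Bool | (∃ cs : List ℕ,
                M.run O (q.eval (encI p F).length) (boolPair (encI p F) r) = some cs ∧ Good p F cs) ∧
              ∀ z ∈ M.queries O (q.eval (encI p F).length) (boolPair (encI p F) r),
                z.length ≤ q.eval (encI p F).length}

/-! ### Registered stubs -/

/-- Registered stub 1 (the steerable quantum re-solver — open, load-bearing). -/
theorem stub_steer : Sig.stub_steer := by
  sorry

/-- Registered stub 2 (gap problem of a uniform family ∈ PromiseBQP — true in print). -/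
theorem stub_gapMem : Sig.stub_gapMem := by
  sorry

/-- Registered stub 3 (guided descent — classical transcript-model plumbing). -/
theorem stub_guidedDescent : Sig.stub_guidedDescent := by
  sorry

/-! ### Sorry-free glue -/

/-- LEAF is automatic: at full length `n` the only admissible completion is `[]`, so a positive
completion-success probability forces the block itself to be Good (an empty success event has
probability `0`). [bookkeeping] -/
theorem good_of_complSucc {Fam : QCircuitFamily cliffordT} {p : ℕ} {F : List (List ℕ)} {τ : List ℕ}
    (hlen : τ.length = (p + 9) / 10) (h : (1 : ℝ) / 3 ≤ complSucc Fam p F τ) : Good p F τ := by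
  by_contra hG
  have hempty :
      {y : List Bool | ∃ cs' : List ℕ, encodingListNatBool.encode cs' <+: y ∧ Good p F (cs' ++ τ)}
        = (∅ : Set (List Bool)) := by
    ext y
    simp only [Set.mem_setOf_eq, Set.mem_empty_iff_false, iff_false, not_exists, not_and]
    intro cs' _ hgood
    have hcs : cs' = [] := by
      rcases cs' with _ | ⟨b, t⟩
      · rfl
      · exfalso
        have h1 := hgood.1
        simp only [List.length_append, List.length_cons, hlen] at h1
        omega
    subst hcs
    exact hG (by simpa using hgood)
  have hzero : complSucc Fam p F τ = 0 := by
    unfold complSucc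
    rw [hempty]
    simp [QCircuitFamily.kernelProb]
  rw [hzero] at h
  norm_num at h

/-- A steering family's gap problem is a prefix guide, with liveness `1/3 ≤ complSucc`: ROOT and
EXTENSION are the two clauses of `Steers`; SOUNDNESS is `¬ (s < 1/3) → 1/3 ≤ s`; LEAF is
`good_of_complSucc`. [bookkeeping] -/
theorem isPrefixGuide_of_steers {Fam : QCircuitFamily cliffordT} {P₀ : ℕ} (h : Steers Fam P₀) :
    IsPrefixGuide (GapQ Fam) P₀ := by
  refine ⟨fun p F τ => (1 : ℝ) / 3 ≤ complSucc Fam p F τ, ?_, ?_, ?_, ?_⟩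
  · intro p F hv
    exact (h p F hv).1
  · intro p F τ hv hlive hlen
    obtain ⟨a, ha, h23⟩ := (h p F hv).2 τ hlen hlive
    exact ⟨a, ha, p, F, a :: τ, rfl, h23⟩
  · intro p F τ a hv hlive hlen ha hno
    by_contra hlt
    exact hno ⟨p, F, a :: τ, rfl, not_le.mp hlt⟩
  · intro p F τ hv hlive hlen
    exact good_of_complSucc hlen hlive

/-! ### Composition -/

/-- **The line closes the crux BY NAME modulo the three registered stubs.** From stub 1 take the
steering family `Fam` and `P₀`; stub 2 puts `Q := GapQ Fam` in `PromiseBQP`; `isPrefixGuide_of_steers`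
makes `Q` a prefix guide; stub 3 turns the guide into the oracle algorithm with the crux's success
clause for every oracle consistent with `Q`. [bookkeeping] -/
theorem OpiLiftPromise_of :
    Sig.stub_steer → Sig.stub_gapMem → Sig.stub_guidedDescent →
      Summit.QuantumAdvantage.QuantumAdvantage.Theses.CodeCarries.OpiLiftPromise := by
  rintro ⟨Fam, hof, hun, P₀, hsteer⟩ hgap hdesc
  obtain ⟨M, hM, q, k, P₁, hrun⟩ := hdesc (GapQ Fam) P₀ (isPrefixGuide_of_steers hsteer)
  refine ⟨GapQ Fam, hgap Fam hof hun, M, hM, q, k, P₁, ?_⟩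
  intro O hyes hno p F hv
  exact hrun O hyes hno p F hv

/-- The skeleton in its final shape (D-0027 §3.3): the crux BY NAME from the three registered stubs; it
becomes the crux proof when the last `stub_*` is discharged (until then it depends on `sorryAx`
through the stubs only — no `sorry` of its own). -/
theorem OpiLiftPromise_proof :
    Summit.QuantumAdvantage.QuantumAdvantage.Theses.CodeCarries.OpiLiftPromise :=
  OpiLiftPromise_of stub_steer stub_gapMem stub_guidedDescent

end Summit.QuantumAdvantage.QuantumAdvantage.Cruxes.OpiLiftPromise.Birth
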